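import Literature.Computability.AlgebraicComplexity.BlockWalks
import HarnessLib

/-!
# The second moment of one block: `E[∑_γ D^{-Δ(β,γ)}]` via the transfer recursion
(Kumar–Saraf 2017, Prop. 9.1, Lemmas 9.2–9.4)

Topic `Literature/Computability/AlgebraicComplexity`; infrastructure for the printed proof of
`kumarSaraf2017_imm_homDepthFour` (`HomogeneousDepthFour.lean`), Step 5 of the roadmap: for one
block of `k` regular layers with row degrees `deg`, a fixed vertex walk `p`, and the walks `q` from
a prescribed start vertex, the pair count weighted by `D^{|agree p q|}` (`= D^{k - Δ(p,q)}`) is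
bounded through the run-weighted subset sums of `TransferRecursion.lean`:

* `pairWeight D deg A = ∏_{j ∈ A} ñ D / deg_j`; `pairWeight_agree_bound` — for every `q`,
  `#{ω : p, q alive} · D^{|agree|} ≤ |Ω| (∏ deg)² ñ^{-2k} · pairWeight (agree p q)`
  (from `card_bothAlive_mul_le`).
* `sum_pairWeight_agree_le` — regrouping the walks `q` by their agreement set and counting them by
  prescribed positions (`card_walks_prescribed_le`, `card_insert_zero_positions`):
  `∑_{q} pairWeight (agree p q) ≤ ñ^k · ∑_{A ⊆ [k]} runWeight w (1/ñ) init A` with `w_j = D/deg_j`,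
  for the walks from the same start (`init = true`) or from a different start (`init = false`).
* **`block_pair_sum_le_sameStart`**, **`block_pair_sum_le_diffStart`** —
  `∑_{q from s} #{ω : p, q alive} · D^{|agree p q|} ≤ |Ω| · (∏_j deg_j)² / ñ^k · ∑_A runWeight`
  (weights `wOf = D/deg`, resp. `wOf0` — the same with weight `0` on the first layer, where walks from
  different starts cannot agree), the per-block form of [KS, Prop. 9.1] (`E_V[∑_γ D^{-Δ(β,γ)}]`, up to the normalisations
  `D^{-Δ} = D^{-k} D^{|agree|}` and `Pr[p alive] = ∏ deg/ñ`), to be combined with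
  `sum_runWeight_le_of_sameStart` (`O(1)`, Lemma 9.2) and `sum_runWeight_le_of_diffStart`
  (`1 + o(1)`, Lemma 9.4).

Everything is proved; no named facts.

## References

* M. Kumar, S. Saraf, *On the power of homogeneous depth 4 arithmetic circuits*, SIAM J. Comput.
  46 (2017) 336–387 (arXiv:1404.1950): Prop. 9.1, Lemmas 9.2–9.4.
-/

namespace Literature.Computability.AlgebraicComplexity.KumarSaraf

open Finset

variable {k n : ℕ}

/-- The pair weight of an agreement set: `∏_{j ∈ A} ñ D / deg_j`. [cite: KumarSaraf2017, Prop. 9.1] -/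
noncomputable def pairWeight (D : ℝ) (deg : Fin k → ℕ) (A : Finset (Fin k)) : ℝ :=
  ∏ j ∈ A, (n : ℝ) * D / deg j

/-- The transfer weights `w_j = D / deg_j` (as a function on `ℕ`, `0` beyond `k`).
[cite: KumarSaraf2017, Lemma 9.2] -/
noncomputable def wOf (D : ℝ) (deg : Fin k → ℕ) : ℕ → ℝ :=
  fun j => if h : j < k then D / deg ⟨j, h⟩ else 0

/-- The transfer weights are non-negative. [folklore] -/
theorem wOf_nonneg {D : ℝ} (hD : 0 ≤ D) (deg : Fin k → ℕ) : ∀ j, 0 ≤ wOf D deg j := by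
  intro j; unfold wOf; split_ifs <;> positivity

/-- The transfer weights for walks from a different start: no agreement is possible in the first
layer, so its weight is `0`. [cite: KumarSaraf2017, Lemma 9.4] -/
noncomputable def wOf0 (D : ℝ) (deg : Fin k → ℕ) : ℕ → ℝ :=
  fun j => if j = 0 then 0 else wOf D deg j

/-- The different-start transfer weights are non-negative and vanish at `0`. [folklore] -/
theorem wOf0_nonneg {D : ℝ} (hD : 0 ≤ D) (deg : Fin k → ℕ) : ∀ j, 0 ≤ wOf0 D deg j := by
  intro j; unfold wOf0; split_ifs
  · exact le_rfl
  · exact wOf_nonneg hD deg j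

/-- `wOf0` vanishes at the first layer. [folklore] -/
@[simp] theorem wOf0_zero (D : ℝ) (deg : Fin k → ℕ) : wOf0 D deg 0 = 0 := by simp [wOf0]

/-- `wOf0` agrees with `wOf` beyond the first layer. [folklore] -/
theorem wOf0_of_ne_zero (D : ℝ) (deg : Fin k → ℕ) {j : ℕ} (hj : j ≠ 0) : wOf0 D deg j = wOf D deg j := by
  simp [wOf0, hj]

/-- **Per pair** (from `card_bothAlive_mul_le`): for walks `p, q` in a block with degrees
`deg ≥ 1` on `ñ ≥ 1` vertices,
`#{ω : p, q alive} · D^{|agree p q|} ≤ |Ω| · (∏ deg)² · ñ^{-2k} · pairWeight (agree p q)`.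
[cite: KumarSaraf2017, Prop. 9.1] -/
theorem pairWeight_agree_bound (deg : Fin k → ℕ) (hdeg : ∀ j, 1 ≤ deg j) (hn : 1 ≤ n) {D : ℝ}
    (hD : 0 ≤ D) (p q : Walk k n) :
    (((rowSpace (fun ρ : Fin k × Fin n => deg ρ.1)).filter (fun ω => Alive ω p ∧ Alive ω q)).card
        : ℝ) * D ^ (agree p q).card ≤
      ((rowSpace (α := Fin n) (fun ρ : Fin k × Fin n => deg ρ.1)).card : ℝ) *
        (∏ j, (deg j : ℝ)) ^ 2 / (n : ℝ) ^ (2 * k) * pairWeight (n := n) D deg (agree p q) := by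
  have h := card_bothAlive_mul_le deg p q
  set cnt := ((rowSpace (fun ρ : Fin k × Fin n => deg ρ.1)).filter
    (fun ω => Alive ω p ∧ Alive ω q)).card with hcnt
  set Ω := (rowSpace (α := Fin n) (fun ρ : Fin k × Fin n => deg ρ.1)).card with hΩ
  set a := (agree p q).card with ha
  have hak : a ≤ k := by
    rw [ha, agree]; exact (card_filter_le _ _).trans (by rw [card_univ, Fintype.card_fin])
  have hnpos : (0 : ℝ) < n := by exact_mod_cast hn
  have hdegpos : ∀ j, (0 : ℝ) < deg j := fun j => by exact_mod_cast hdeg j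
  have hPpos : (0 : ℝ) < ∏ j ∈ agree p q, (deg j : ℝ) := prod_pos fun j _ => hdegpos j
  -- cast the counting inequality
  have hcast : (cnt : ℝ) * (n : ℝ) ^ (2 * k - a) * ∏ j ∈ agree p q, (deg j : ℝ) ≤
      (Ω : ℝ) * (∏ j, (deg j : ℝ)) ^ 2 := by exact_mod_cast h
  -- `pairWeight A = ñ^a D^a / ∏_{A} deg`
  have hpw : pairWeight (n := n) D deg (agree p q) * ∏ j ∈ agree p q, (deg j : ℝ) =
      ((n : ℝ) * D) ^ a := by
    unfold pairWeight
    rw [← prod_mul_distrib, ha, ← prod_const]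
    refine prod_congr rfl fun j _ => ?_
    field_simp [(hdegpos j).ne']
  -- multiply the goal by the positive `ñ^{2k-a} ∏_A deg`
  have hnk : (n : ℝ) ^ (2 * k) = (n : ℝ) ^ (2 * k - a) * (n : ℝ) ^ a := by
    rw [← pow_add, Nat.sub_add_cancel (by omega)]
  rw [div_mul_eq_mul_div, le_div_iff₀ (by positivity), hnk]
  have key : (cnt : ℝ) * D ^ a * ((n : ℝ) ^ (2 * k - a) * (n : ℝ) ^ a) *
      ∏ j ∈ agree p q, (deg j : ℝ) ≤
      (Ω : ℝ) * (∏ j, (deg j : ℝ)) ^ 2 * pairWeight (n := n) D deg (agree p q) *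
        ∏ j ∈ agree p q, (deg j : ℝ) := by
    calc (cnt : ℝ) * D ^ a * ((n : ℝ) ^ (2 * k - a) * (n : ℝ) ^ a) * ∏ j ∈ agree p q, (deg j : ℝ)
        = ((cnt : ℝ) * (n : ℝ) ^ (2 * k - a) * ∏ j ∈ agree p q, (deg j : ℝ)) * ((n : ℝ) * D) ^ a := by
          rw [mul_pow]; ring
      _ ≤ ((Ω : ℝ) * (∏ j, (deg j : ℝ)) ^ 2) * ((n : ℝ) * D) ^ a :=
          mul_le_mul_of_nonneg_right hcast (by positivity)
      _ = _ := by rw [← hpw]; ring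
  exact le_of_mul_le_mul_right key hPpos

/-- **Regrouping by agreement sets** ([KS, Prop. 9.1 via Lemmas 9.3–9.4]): if for every `A` the
walks of `Q` whose agreement set with `p` is exactly `A` number at most
`ñ^{k - |A| - runCost init A}` (with `|A| + runCost init A ≤ k`), then
`∑_{q ∈ Q} pairWeight (agree p q) ≤ ñ^k ∑_{A ⊆ [k]} runWeight (D/deg) (1/ñ) init A`.
[cite: KumarSaraf2017, Prop. 9.1] -/
theorem sum_pairWeight_agree_le (deg : Fin k → ℕ) (hdeg : ∀ j, 1 ≤ deg j) (hn : 1 ≤ n) {D : ℝ}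
    (hD : 0 ≤ D) (p : Walk k n) (Q : Finset (Walk k n)) (init : Bool)
    (hcnt : ∀ A : Finset (Fin k), ((Q.filter fun q => agree p q = A).card : ℝ) ≤
      (n : ℝ) ^ k / ((n : ℝ) ^ A.card * (n : ℝ) ^ runCost init (natLayers A)))
    (w : ℕ → ℝ) (hw : ∀ j, 0 ≤ w j)
    (hwle : ∀ A : Finset (Fin k), (Q.filter fun q => agree p q = A).card ≠ 0 →
      ∀ x ∈ natLayers A, wOf D deg x ≤ w x) :
    ∑ q ∈ Q, pairWeight (n := n) D deg (agree p q) ≤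
      (n : ℝ) ^ k * ∑ A ∈ (range k).powerset, runWeight w (1 / n) init A := by
  classical
  have hnpos : (0 : ℝ) < n := by exact_mod_cast hn
  have hdegpos : ∀ j, (0 : ℝ) < deg j := fun j => by exact_mod_cast hdeg j
  have hpw0 : ∀ A, 0 ≤ pairWeight (n := n) D deg A := fun A => prod_nonneg fun j _ => by positivity
  -- fiberwise over the agreement set
  rw [← sum_fiberwise_of_maps_to (g := fun q => agree p q) (t := (univ : Finset (Finset (Fin k))))
    (fun _ _ => mem_univ _)]
  have hfib : ∀ A : Finset (Fin k), ∑ q ∈ Q.filter (fun q => agree p q = A),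
      pairWeight (n := n) D deg (agree p q) =
      ((Q.filter fun q => agree p q = A).card : ℝ) * pairWeight (n := n) D deg A := by
    intro A
    rw [sum_congr rfl fun q hq => by rw [(mem_filter.1 hq).2], sum_const, nsmul_eq_mul]
  rw [sum_congr rfl fun A _ => hfib A]
  -- reindex the run weights by `A ↦ natLayers A`
  have hre : ∑ A ∈ (range k).powerset, runWeight w (1 / n) init A =
      ∑ A : Finset (Fin k), runWeight w (1 / n) init (natLayers A) := by
    refine (sum_nbij' natLayers (fun B => B.preimage Fin.val Fin.val_injective.injOn)
      ?_ ?_ ?_ ?_ ?_).symm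
    · intro A _; exact mem_powerset.2 (natLayers_subset A)
    · intro B _; exact mem_univ _
    · intro A _
      ext j
      rw [mem_preimage, mem_natLayers]
      exact ⟨fun ⟨_, h⟩ => h, fun h => ⟨j.2, h⟩⟩
    · intro B hB
      rw [mem_powerset] at hB
      ext x
      rw [mem_natLayers]
      constructor
      · rintro ⟨h, hx⟩; exact mem_preimage.1 hx
      · intro hx; exact ⟨mem_range.1 (hB hx), mem_preimage.2 hx⟩
    · intro A _; rfl
  rw [hre, mul_sum]
  refine sum_le_sum fun A _ => ?_
  -- `pairWeight A = ñ^{|A|} ∏_{A} w`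
  have hpwA : pairWeight (n := n) D deg A = (n : ℝ) ^ A.card * ∏ x ∈ natLayers A, wOf D deg x := by
    unfold pairWeight
    rw [natLayers, prod_map, ← prod_const, ← prod_mul_distrib]
    refine prod_congr rfl fun j _ => ?_
    rw [Fin.valEmbedding_apply, wOf, dif_pos j.2]
    rw [mul_div_assoc]
  rw [hpwA]
  unfold runWeight
  have hc := hcnt A
  have hprod0 : 0 ≤ ∏ x ∈ natLayers A, wOf D deg x := prod_nonneg fun x _ => wOf_nonneg hD deg x
  have hprodw : 0 ≤ ∏ x ∈ natLayers A, w x := prod_nonneg fun x _ => hw x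
  by_cases hzero : (Q.filter fun q => agree p q = A).card = 0
  · rw [hzero, Nat.cast_zero, zero_mul]; positivity
  have hle : ∏ x ∈ natLayers A, wOf D deg x ≤ ∏ x ∈ natLayers A, w x :=
    prod_le_prod (fun x _ => wOf_nonneg hD deg x) (hwle A hzero)
  calc ((Q.filter fun q => agree p q = A).card : ℝ) * ((n : ℝ) ^ A.card * ∏ x ∈ natLayers A, wOf D deg x)
      ≤ ((Q.filter fun q => agree p q = A).card : ℝ) * ((n : ℝ) ^ A.card * ∏ x ∈ natLayers A, w x) :=
        mul_le_mul_of_nonneg_left (mul_le_mul_of_nonneg_left hle (by positivity)) (by positivity)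
    _ ≤ (n : ℝ) ^ k / ((n : ℝ) ^ A.card * (n : ℝ) ^ runCost init (natLayers A)) *
          ((n : ℝ) ^ A.card * ∏ x ∈ natLayers A, w x) :=
        mul_le_mul_of_nonneg_right hc (by positivity)
    _ = (n : ℝ) ^ k * ((1 / n) ^ runCost init (natLayers A) * ∏ x ∈ natLayers A, w x) := by
        rw [one_div, inv_pow]
        field_simp

/-- **Counting the fibre, same start**: the walks `q` from `p 0` with agreement set exactly `A`
have the vertices of `p` on `{0} ∪ positions A`, hence number at most
`ñ^{k+1-|{0} ∪ positions A|} = ñ^{k - |A| - runCost true A}`. [cite: KumarSaraf2017, Lemma 9.3] -/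
theorem card_fiber_sameStart_le (hn : 1 ≤ n) (p : Walk k n) (A : Finset (Fin k)) :
    ((((univ : Finset (Walk k n)).filter fun q => q 0 = p 0).filter fun q => agree p q = A).card : ℝ)
      ≤ (n : ℝ) ^ k / ((n : ℝ) ^ A.card * (n : ℝ) ^ runCost true (natLayers A)) := by
  classical
  have hnpos : (0 : ℝ) < n := by exact_mod_cast hn
  have hsub : (((univ : Finset (Walk k n)).filter fun q => q 0 = p 0).filter fun q => agree p q = A)
      ⊆ (univ : Finset (Walk k n)).filter fun q => ∀ i ∈ insert 0 (positions A), q i = p i := by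
    intro q hq
    rw [mem_filter, mem_filter] at hq
    refine mem_filter.2 ⟨mem_univ _, fun i hi => ?_⟩
    rw [mem_insert] at hi
    rcases hi with rfl | hi
    · exact hq.1.2
    · exact eq_on_positions (hq.2 ▸ subset_rfl) i hi
  have h1 := (card_le_card hsub).trans (card_walks_prescribed_le p (insert 0 (positions A)))
  rw [card_insert_zero_positions] at h1
  have hle : A.card + runCost true (natLayers A) + 1 ≤ k + 1 := by
    have := card_le_univ (insert (0 : Fin (k + 1)) (positions A))
    rw [Fintype.card_fin, card_insert_zero_positions] at this
    exact this
  rw [le_div_iff₀ (by positivity), ← pow_add]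
  calc _ ≤ ((n ^ (k + 1 - (A.card + runCost true (natLayers A) + 1)) : ℕ) : ℝ) *
        (n : ℝ) ^ (A.card + runCost true (natLayers A)) := by
        exact_mod_cast Nat.mul_le_mul_right _ h1
    _ = (n : ℝ) ^ k := by
        push_cast
        rw [← pow_add]
        congr 1
        omega

/-- **No agreement in the first layer from a different start**: for `s ≠ p 0`, no walk from
`s` has an agreement set with `p` containing the first layer. [cite: KumarSaraf2017, Lemma 9.4] -/
theorem fiber_diffStart_eq_empty (p : Walk k n) {s : Fin n} (hs : s ≠ p 0) {A : Finset (Fin k)}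
    (hk : 0 < k) (hzA : (⟨0, hk⟩ : Fin k) ∈ A) :
    (((univ : Finset (Walk k n)).filter fun q => q 0 = s).filter fun q => agree p q = A) = ∅ := by
  classical
  rw [filter_eq_empty_iff]
  intro q hq hA
  rw [mem_filter] at hq
  have hmem : (⟨0, hk⟩ : Fin k) ∈ agree p q := hA ▸ hzA
  have := (mem_filter.1 hmem).2
  have h0 : p 0 = q 0 := (Prod.ext_iff.1 (Prod.ext_iff.1 this).2).1
  exact hs (hq.2.symm.trans h0.symm)

/-- **Counting the fibre, different start**: for `s ≠ p 0`, the walks `q` from `s` with agreement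
set exactly `A` are none if `A` contains the first layer, and otherwise have prescribed vertices
on `{0} ∪ positions A` (`0 ∉ positions A`), hence number at most `ñ^{k - |A| - runCost false A}`
(every run of agreements is charged). [cite: KumarSaraf2017, Lemma 9.4] -/
theorem card_fiber_diffStart_le (hn : 1 ≤ n) (p : Walk k n) {s : Fin n} (hs : s ≠ p 0)
    (A : Finset (Fin k)) :
    ((((univ : Finset (Walk k n)).filter fun q => q 0 = s).filter fun q => agree p q = A).card : ℝ)
      ≤ (n : ℝ) ^ k / ((n : ℝ) ^ A.card * (n : ℝ) ^ runCost false (natLayers A)) := by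
  classical
  have hnpos : (0 : ℝ) < n := by exact_mod_cast hn
  by_cases hz : ∃ h : 0 < k, (⟨0, h⟩ : Fin k) ∈ A
  · -- no walk from `s` agrees with `p` on the first layer
    obtain ⟨hk, hzA⟩ := hz
    rw [fiber_diffStart_eq_empty p hs hk hzA, card_empty, Nat.cast_zero]
    positivity
  · push Not at hz
    obtain ⟨hcard, h0⟩ := card_positions_of_zero_notMem A hz
    set t : Walk k n := Function.update p 0 s with ht
    have hsub : (((univ : Finset (Walk k n)).filter fun q => q 0 = s).filter fun q => agree p q = A)
        ⊆ (univ : Finset (Walk k n)).filter fun q => ∀ i ∈ insert 0 (positions A), q i = t i := by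
      intro q hq
      rw [mem_filter, mem_filter] at hq
      refine mem_filter.2 ⟨mem_univ _, fun i hi => ?_⟩
      rw [mem_insert] at hi
      rcases hi with rfl | hi
      · rw [ht, Function.update_self]; exact hq.1.2
      · have hi0 : i ≠ 0 := fun h => h0 (h ▸ hi)
        rw [ht, Function.update_of_ne hi0]
        exact eq_on_positions (hq.2 ▸ subset_rfl) i hi
    have h1 := (card_le_card hsub).trans (card_walks_prescribed_le t (insert 0 (positions A)))
    rw [card_insert_of_notMem h0, hcard] at h1
    have hle : A.card + runCost false (natLayers A) + 1 ≤ k + 1 := by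
      have := card_le_univ (insert (0 : Fin (k + 1)) (positions A))
      rw [Fintype.card_fin, card_insert_of_notMem h0, hcard] at this
      exact this
    rw [le_div_iff₀ (by positivity), ← pow_add]
    calc _ ≤ ((n ^ (k + 1 - (A.card + runCost false (natLayers A) + 1)) : ℕ) : ℝ) *
          (n : ℝ) ^ (A.card + runCost false (natLayers A)) := by
          exact_mod_cast Nat.mul_le_mul_right _ h1
      _ = (n : ℝ) ^ k := by
          push_cast
          rw [← pow_add]
          congr 1
          omega

/-- **The second moment of one block, same start** ([KS, Prop. 9.1 with Lemmas 9.2–9.3]): for a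
block with degrees `deg ≥ 1` on `ñ ≥ 1` vertices, `D ≥ 0`, and a walk `p`,
`∑_{q from p 0} #{ω : p, q alive} · D^{|agree p q|} ≤
|Ω| · (∏_j deg_j)² / ñ^k · ∑_{A ⊆ [k]} runWeight (D/deg) (1/ñ) true A`.
[cite: KumarSaraf2017, Prop. 9.1] -/
theorem block_pair_sum_le_sameStart (deg : Fin k → ℕ) (hdeg : ∀ j, 1 ≤ deg j) (hn : 1 ≤ n)
    {D : ℝ} (hD : 0 ≤ D) (p : Walk k n) :
    ∑ q ∈ (univ : Finset (Walk k n)).filter (fun q => q 0 = p 0),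
        (((rowSpace (fun ρ : Fin k × Fin n => deg ρ.1)).filter
          (fun ω => Alive ω p ∧ Alive ω q)).card : ℝ) * D ^ (agree p q).card ≤
      ((rowSpace (α := Fin n) (fun ρ : Fin k × Fin n => deg ρ.1)).card : ℝ) *
        (∏ j, (deg j : ℝ)) ^ 2 / (n : ℝ) ^ k *
        ∑ A ∈ (range k).powerset, runWeight (wOf D deg) (1 / n) true A := by
  have hnpos : (0 : ℝ) < n := by exact_mod_cast hn
  set Q := (univ : Finset (Walk k n)).filter (fun q => q 0 = p 0)
  set C := ((rowSpace (α := Fin n) (fun ρ : Fin k × Fin n => deg ρ.1)).card : ℝ) *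
    (∏ j, (deg j : ℝ)) ^ 2 with hC
  have hC0 : 0 ≤ C := by rw [hC]; positivity
  calc _ ≤ ∑ q ∈ Q, C / (n : ℝ) ^ (2 * k) * pairWeight (n := n) D deg (agree p q) :=
        sum_le_sum fun q _ => pairWeight_agree_bound deg hdeg hn hD p q
    _ = C / (n : ℝ) ^ (2 * k) * ∑ q ∈ Q, pairWeight (n := n) D deg (agree p q) := by rw [mul_sum]
    _ ≤ C / (n : ℝ) ^ (2 * k) *
        ((n : ℝ) ^ k * ∑ A ∈ (range k).powerset, runWeight (wOf D deg) (1 / n) true A) :=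
        mul_le_mul_of_nonneg_left (sum_pairWeight_agree_le deg hdeg hn hD p Q true
          (fun A => card_fiber_sameStart_le hn p A) (wOf D deg) (wOf_nonneg hD deg)
          (fun _ _ _ _ => le_rfl)) (by positivity)
    _ = C / (n : ℝ) ^ k * ∑ A ∈ (range k).powerset, runWeight (wOf D deg) (1 / n) true A := by
        rw [two_mul, pow_add]
        field_simp

/-- **The second moment of one block, different starts** ([KS, Prop. 9.1 with Lemma 9.4]): as
`block_pair_sum_le_sameStart` for the walks `q` from a start `s ≠ p 0`, with the run weights
`runWeight … false` (every run of agreements charged `1/ñ`). [cite: KumarSaraf2017, Lemma 9.4] -/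
theorem block_pair_sum_le_diffStart (deg : Fin k → ℕ) (hdeg : ∀ j, 1 ≤ deg j) (hn : 1 ≤ n)
    {D : ℝ} (hD : 0 ≤ D) (p : Walk k n) {s : Fin n} (hs : s ≠ p 0) :
    ∑ q ∈ (univ : Finset (Walk k n)).filter (fun q => q 0 = s),
        (((rowSpace (fun ρ : Fin k × Fin n => deg ρ.1)).filter
          (fun ω => Alive ω p ∧ Alive ω q)).card : ℝ) * D ^ (agree p q).card ≤
      ((rowSpace (α := Fin n) (fun ρ : Fin k × Fin n => deg ρ.1)).card : ℝ) *
        (∏ j, (deg j : ℝ)) ^ 2 / (n : ℝ) ^ k *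
        ∑ A ∈ (range k).powerset, runWeight (wOf0 D deg) (1 / n) false A := by
  classical
  have hnpos : (0 : ℝ) < n := by exact_mod_cast hn
  set Q := (univ : Finset (Walk k n)).filter (fun q => q 0 = s) with hQ
  -- from a different start the first layer never agrees: the weight `wOf0` may be used
  have hwle : ∀ A : Finset (Fin k), (Q.filter fun q => agree p q = A).card ≠ 0 →
      ∀ x ∈ natLayers A, wOf D deg x ≤ wOf0 D deg x := by
    intro A hA x hx
    rw [mem_natLayers] at hx
    obtain ⟨hxk, hxA⟩ := hx
    have hx0 : x ≠ 0 := by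
      rintro rfl
      exact hA (by rw [hQ, fiber_diffStart_eq_empty p hs hxk hxA, card_empty])
    rw [wOf0_of_ne_zero D deg hx0]
  set C := ((rowSpace (α := Fin n) (fun ρ : Fin k × Fin n => deg ρ.1)).card : ℝ) *
    (∏ j, (deg j : ℝ)) ^ 2 with hC
  have hC0 : 0 ≤ C := by rw [hC]; positivity
  calc _ ≤ ∑ q ∈ Q, C / (n : ℝ) ^ (2 * k) * pairWeight (n := n) D deg (agree p q) :=
        sum_le_sum fun q _ => pairWeight_agree_bound deg hdeg hn hD p q
    _ = C / (n : ℝ) ^ (2 * k) * ∑ q ∈ Q, pairWeight (n := n) D deg (agree p q) := by rw [mul_sum]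
    _ ≤ C / (n : ℝ) ^ (2 * k) *
        ((n : ℝ) ^ k * ∑ A ∈ (range k).powerset, runWeight (wOf0 D deg) (1 / n) false A) :=
        mul_le_mul_of_nonneg_left (sum_pairWeight_agree_le deg hdeg hn hD p Q false
          (fun A => card_fiber_diffStart_le hn p hs A) (wOf0 D deg) (wOf0_nonneg hD deg) hwle)
          (by positivity)
    _ = C / (n : ℝ) ^ k * ∑ A ∈ (range k).powerset, runWeight (wOf0 D deg) (1 / n) false A := by
        rw [two_mul, pow_add]
        field_simp

end Literature.Computability.AlgebraicComplexity.KumarSaraf
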